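import Summits.ResolutionOfSingularities.KangarooAtlas.MizutaniOdaEquality
import Summits.ResolutionOfSingularities.KangarooAtlas.MizutaniMultiplicityBridge
import Summits.ResolutionOfSingularities.KangarooAtlas.MizutaniVectorGroup
import Summits.ResolutionOfSingularities.KangarooAtlas.MizutaniAttainedMultiplicity
import HarnessLib

/-!
# Mizutani's conjecture — the chain read in Hironaka's/Mizutani's own vocabulary after Oda's equality

Cell topic `Summits/ResolutionOfSingularities/KangarooAtlas` (pub-rosobs); namespace
`Summit.ResolutionOfSingularities.KangarooAtlas.Mizutani`.  AI-written; *AI review is weaker than expert review*; NOT a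
resolution theorem, NOT summit progress.

`MizutaniOdaEquality.lean` proves Oda's equality `U(𝔭) ∩ L_e = (L_B)_e` (`hirForms_eq_invForms`, Oda 1973 Prop. 2.2 (ii))
for every prime of every `k[X_0, …, X_n]`.  This file records what it buys for the Lean transcription of the in-house
note MIZUTANI-PROOF-g59: the hypothesis `hOda` displayed by `MizutaniMultiplicityBridge.lean` (encloser-1 g3) and by
`MizutaniHironakaDimension.lean` / `MizutaniVectorGroup.lean` (encloser-2 g4) is DISCHARGED.

* `mizutaniLowerBound_hirForms'` — Mizutani's lower bound `2p^e ≤ (n + 1 − dim_k (U(𝔭) ∩ L)_{e₀}) + 1` for a point whose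
  `U(𝔭) ∩ L` (additive forms of multiplicity `p^j` at `𝔭` in degree `p^j`, Mizutani §1 (c)) has exponent `≤ e₀` and not
  `≤ e'` for `e' < e` — UNCONDITIONAL (no cited fact, no displayed hypothesis).
* `exponent_eq_iff_hirForms` — Oda's exponent of `B(𝔭)` (`exponent k p 𝔭`, `MizutaniNumber.lean`) is Mizutani's exponent of
  the graded `k[F]`-module `U(𝔭) ∩ L`.
* Conditional on Hironaka's generation theorem ALONE (`Hironaka1970_thm1_cor`: `U(𝔭)` is generated by additive forms —
  the remaining vocabulary bridge to `B_{P,𝔭} = Spec S/U_+(𝔭)S`): `ringKrullDim_quotient_bIdeal_eq_hsDim'`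
  (`dim B_{P,𝔭} = hsDim`), **`two_mul_pow_exponent_le_ringKrullDim_bIdeal_succ'`** (`2·p^{exponent} ≤ dim B_{P,𝔭} + 1` for
  every point of `ℙ^n_k`: MIZUTANI'S CONJECTURED LOWER BOUND in his own vocabulary), `isVectorGroup_iff_exponent_eq_zero`.

References: [Mizutani1973HironakaGroupSchemes] §1 (Def. 1.1, (c), Rem. 1.2, Thm. 1.3), Remark 2.10;
[Oda1983HironakaGroupSchemeII] §2 (p. 1168); [Hironaka1970AdditiveGroups] Thm. 1 Cor. (as the named fact
`Hironaka1970_thm1_cor` of `Literature/…/HironakaGroupSchemeMultiplicity.lean`).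
-/

open MvPolynomial Literature.AlgebraicGeometry.Resolution Literature.AlgebraicGeometry.Resolution.HironakaScheme

namespace Summit.ResolutionOfSingularities.KangarooAtlas.Mizutani

universe u

section Unconditional

variable {k : Type u} [Field k] {p : ℕ} [hp : Fact p.Prime] [CharP k p] {n : ℕ}
  (𝔭 : Ideal (MvPolynomial (Fin (n + 1)) k)) [h𝔭 : 𝔭.IsPrime]

/-- **Mizutani's lower bound `m(e) ≥ 2p^e − 1` in Hironaka's own reading**, UNCONDITIONALLY: for a point `𝔭` of
`ℙ^n_k` whose `U(𝔭) ∩ L` (additive forms of multiplicity `p^j` at `𝔭` in degree `p^j`, Mizutani §1 (c)) has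
exponent `≤ e₀` and not `≤ e'` for any `e' < e`, `2p^e ≤ (n + 1 − dim_k (U(𝔭) ∩ L)_{e₀}) + 1`.  This is
`MizutaniMultiplicityBridge.mizutaniLowerBound_hirForms` with its hypothesis `hOda` discharged by
`hirForms_eq_invForms`.  (The identification of `n + 1 − dim_k (U ∩ L)_{e₀}` with `dim B(𝔭)` is Hironaka's
Thm. 1 Cor. / Mizutani Thm. 1.3, see `two_mul_pow_exponent_le_ringKrullDim_bIdeal_succ'` below.)
[cite: Mizutani1973HironakaGroupSchemes, §1 (c), Thm. 1.3 and Remark 2.10] -/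
theorem mizutaniLowerBound_hirForms' (hP : IsPoint k 𝔭) {e e₀ : ℕ}
    (he₀ : ∀ j, e₀ ≤ j → hirForms k p 𝔭 j =
      Submodule.span k (frobVec k p (j - e₀) '' (hirForms k p 𝔭 e₀ : Set (Fin (n + 1) → k))))
    (hlt : ∀ e', e' < e → ¬ ∀ j, e' ≤ j → hirForms k p 𝔭 j =
      Submodule.span k (frobVec k p (j - e') '' (hirForms k p 𝔭 e' : Set (Fin (n + 1) → k)))) :
    2 * p ^ e ≤ (n + 1 - Module.finrank k (hirForms k p 𝔭 e₀)) + 1 :=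
  mizutaniLowerBound_hirForms (hirForms_eq_invForms 𝔭) hP he₀ hlt

/-- **Oda's exponent is Mizutani's**: `exponent k p 𝔭 = e` iff `e` is the least level from which on
`(U ∩ L)_j = k·F^{j−e}(U ∩ L)_e` (Mizutani §1 (a), (c): the exponent of the graded `k[F]`-module `U(𝔭) ∩ L`).
[cite: Mizutani1973HironakaGroupSchemes, §1 (a), (c); Oda1983HironakaGroupSchemeII, §2 (p. 1168)] -/
theorem exponent_eq_iff_hirForms (e : ℕ) :
    exponent k p 𝔭 = e ↔
      (∀ j, e ≤ j → hirForms k p 𝔭 j =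
          Submodule.span k (frobVec k p (j - e) '' (hirForms k p 𝔭 e : Set (Fin (n + 1) → k)))) ∧
        ∀ e', e' < e → ¬ ∀ j, e' ≤ j → hirForms k p 𝔭 j =
          Submodule.span k (frobVec k p (j - e') '' (hirForms k p 𝔭 e' : Set (Fin (n + 1) → k))) := by
  rw [exponent_eq_iff]
  simp only [exponentLE_iff_hirForms]

/-- The dimension `hsDim` read through `U(𝔭) ∩ L`: `hsDim k p 𝔭 = n + 1 − dim_k (U(𝔭) ∩ L)_{e₀}` for any `e₀` at or
above the exponent (Mizutani Thm. 1.3's right-hand side `dim_k (L_e/N_e)`).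
[cite: Mizutani1973HironakaGroupSchemes, Thm. 1.3] -/
theorem hsDim_eq_hirForms {e₀ : ℕ}
    (he₀ : ∀ j, e₀ ≤ j → hirForms k p 𝔭 j =
      Submodule.span k (frobVec k p (j - e₀) '' (hirForms k p 𝔭 e₀ : Set (Fin (n + 1) → k)))) :
    hsDim k p 𝔭 = n + 1 - Module.finrank k (hirForms k p 𝔭 e₀) := by
  have hE : ExponentLE k p 𝔭 e₀ := (exponentLE_iff_hirForms 𝔭 e₀).mpr he₀
  rw [← hsDimAt_eq_hsDim k p 𝔭 hE]
  unfold hsDimAt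
  rw [hirForms_eq_invForms]

end Unconditional

/-! ## Conditional on Hironaka's generation theorem alone -/

section HironakaOnly

variable (k : Type u) [Field k] (p : ℕ) [hp : Fact p.Prime] [CharP k p] {n : ℕ}
  (𝔭 : Ideal (MvPolynomial (Fin (n + 1)) k))

/-- **`dim B_{P,𝔭} = hsDim k p 𝔭`** (Krull dimension of `S/U_+(𝔭)S` = Oda's rank formula), conditional on Hironaka's
generation theorem `Hironaka1970_thm1_cor` ONLY (Oda's equality is now a theorem: `hirForms_eq_invForms`).
[cite: Mizutani1973HironakaGroupSchemes, Thm. 1.3; Oda1983HironakaGroupSchemeII, §2 (p. 1168)] -/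
theorem ringKrullDim_quotient_bIdeal_eq_hsDim' [𝔭.IsPrime] (hH : Hironaka1970_thm1_cor.{u} p) (hP : IsPoint k 𝔭) :
    ringKrullDim (MvPolynomial (Fin (n + 1)) k ⧸ bIdeal k 𝔭) = (hsDim k p 𝔭 : WithBot ℕ∞) :=
  ringKrullDim_quotient_bIdeal_eq_hsDim k p 𝔭 hH (hirForms_eq_invForms 𝔭) hP

/-- **MIZUTANI'S LOWER BOUND IN HIS OWN VOCABULARY**: for every point `𝔭` of `ℙ^n_k` (any field `k` of characteristic
`p`), `2·p^{exponent B(𝔭)} ≤ dim B_{P,𝔭} + 1` where `B_{P,𝔭} = Spec S/U_+(𝔭)S` is Hironaka's scheme and the exponent is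
that of `U(𝔭) ∩ L` (`exponent_eq_iff_hirForms`) — i.e. `m(e) ≥ 2p^e − 1` (Mizutani 1973 Remark 2.10, conjectured),
conditional ONLY on Hironaka's generation theorem `Hironaka1970_thm1_cor` ("`U(𝔭)` is generated by additive forms",
Hironaka 1970 Thm. 1 Cor., a cited named fact); the inequality itself is the tree's `mizutaniLowerBound`.
[cite: Mizutani1973HironakaGroupSchemes, Remark 2.10 ("it is quite likely that m(e) = 2p^e − 1")] -/
theorem two_mul_pow_exponent_le_ringKrullDim_bIdeal_succ' [𝔭.IsPrime] (hH : Hironaka1970_thm1_cor.{u} p)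
    (hP : IsPoint k 𝔭) :
    (2 * p ^ exponent k p 𝔭 : WithBot ℕ∞) ≤ ringKrullDim (MvPolynomial (Fin (n + 1)) k ⧸ bIdeal k 𝔭) + 1 :=
  two_mul_pow_exponent_le_ringKrullDim_bIdeal_succ k p 𝔭 hH (hirForms_eq_invForms 𝔭) hP

/-- **Vector groups**: `B_{P,𝔭}` is a vector group (`U_+(𝔭)S` generated by linear forms) as soon as the exponent is `0`,
conditional on `Hironaka1970_thm1_cor` only (Mizutani Rem. 1.2). [cite: Mizutani1973HironakaGroupSchemes, Rem. 1.2 (p. 86)] -/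
theorem isVectorGroup_of_exponent_eq_zero [𝔭.IsPrime] (hH : Hironaka1970_thm1_cor.{u} p) (hP : IsPoint k 𝔭)
    (h0 : exponent k p 𝔭 = 0) : IsVectorGroup k 𝔭 :=
  isVectorGroup_of_exponentLE_zero k p 𝔭 hH (hirForms_eq_invForms 𝔭) hP ((exponent_le_iff k p 𝔭).mp h0.le)

end HironakaOnly

end Summit.ResolutionOfSingularities.KangarooAtlas.Mizutani
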